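import Summits.BirchSwinnertonDyer.BirchSwinnertonDyer.Theorems.GoldfeldAllTwistsTwoConverseTwinQuarterTraceOfPrint
import Literature.NumberTheory.QuadraticFields.RedeiReichardtTwoPQ
import Literature.NumberTheory.QuadraticFields.RedeiReichardtCertificates
import Literature.NumberTheory.EllipticCurves.LiLiuTian2024.CongruentNumberRedeiFamilies
import Literature.NumberTheory.ComplexMultiplication.CMLatticeOrderOfDiscriminant
import Literature.NumberTheory.QuadraticFields.FundamentalDiscriminant
import Literature.NumberTheory.QuadraticFields.DedekindZetaReducedForms
import HarnessLib

set_option linter.dupNamespace false -- namespace `…BirchSwinnertonDyer.BirchSwinnertonDyer…` is the cell's (D-0017 nested layout)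
set_option autoImplicit false

/-!
# LINE C3⁺, tranche 4, file R: the RÉDEI DISCHARGE of the three class-group side conditions of THEOREM A⁗_β
# (`hNo4`, `h4e`, `h8`) — all three are the single Legendre condition `(p/q) = −1`

Cell `bsd-goldfeld`, seat `bsd-goldfeld-s1p-c3x` (gen 9); planner ORDER (cclxxv) «TRANCHE 4», file R (re-based by (cclxxvi)(C)).
`--supports stmt-BirchSwinnertonDyer-20044` as a HELPER (nothing is closed). Theses-free; theorems only; no definition, no `sorry`,
no new fact, no file-level `Classical` attribute. HONEST FRAMING: BSD is not proved by any of this; items 19350 / 20044 stay OPEN.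

THEOREM A⁗_β (`heegnerNonTorsion_negEightTwoPrimes_beta_of_print`, file A2b) carries, besides its THIRTEEN named print facts, three
LITERAL class-group hypotheses: `hNo4 : LiLiuTian2024.NoIdealClassOfOrderFour (−qp)` (ideal classes of `ℚ(√−qp)`), `h4e : 4 ∤ #Cl(𝒪_{−qp})`
and `h8 : 8 ∤ #Cl(𝒪_{d_K})`, `d_K = −8qp` (both on the tree's abstract-order carrier `ClassGroup (OrderCl.QO Δ)`). This file DISCHARGES
all three from the tree's PROVED Rédei–Reichardt theorem (`redeiReichardt_fourTwoCard_classGroup_holds`, and its proved special case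
`fourTwoCard_classGroup_eq_one_of_sqrt_neg_two_mul_primes`), leaving the one arithmetic condition `jacobiSym p q = −1`:
* §1 `not_dvd_natCard_of_fourTwoCard_eq_one` — `#G[2] = 2^a`, `#(G² ∩ G[2]) = 1` ⟹ `2^{a+1} ∤ #G` (squaring map; `G²` has odd order).
* §2 the forms↔ideals bridge BY CARDINALITY, `natCard_classGroup_QO_negDiscr_eq : #Cl(𝒪_{d_K}) = #Cl(𝓞 K)` — Cox Thm. 7.7 (ii) on both
  carriers (`CMTypeLattice.natCard_classGroup_QO_of_emod_four`, `Quadratic.card_reducedForms_eq_classNumber`); a `≃*` is composable from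
  `CMTypeLattice.nonempty_mulEquiv_classGroup_QO` + `exists_mulEquiv_classGroup_ringOfIntegers_of_conductor_one` but only `#` is needed.
* §3 `D = −qp`: `RM(−qp) = [[1,1],[1,1]]` on `(q, p)` when `(p/q) = −1` (`redeiMatrix_negTwoPrimes`), kernel `2`, hence
  `noIdealClassOfOrderFour_negTwoPrimes` (= `hNo4`) and, with Gauss's `#Cl[2] = 2` and §1–§2, `not_four_dvd_natCard_classGroup_QO_negTwoPrimes`
  (= `h4e`); §4 `d_K = −8qp`: `#Cl_K[2] = 4`, `r₄ = 0`, §1–§2 ⟹ `not_eight_dvd_natCard_classGroup_QO_negEightTwoPrimes` (= `h8`).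
* §5 `heegnerNonTorsion_negEightTwoPrimes_beta_of_print'` + consumers: A2b's statements with `hNo4 h4e h8` REPLACED by `jacobiSym p q = −1`
  («bridge absent: none»). When `(p/q) = +1`, `hNo4`/`h4e` are FALSE (`r₄(Cl(ℚ(√−qp))) = 1`): the cells C6 ∪ C8 of A⁗ ARE `{(p/q) = −1}`.
References: [LiMa2008] 0.1–0.4; [RedeiReichardt1934]; [Stevenhagen1995RedeiMatrices] §2; [Cox2013] §§3.A–B, 7.B; [Gross1984] §§4–5; [GrossLMS1991] 5.3.
-/

noncomputable section

open Matrix NumberField WeierstrassCurve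
open Literature.NumberTheory Literature.NumberTheory.EllipticCurves Literature.NumberTheory.EllipticCurves.ModularForms
  Literature.NumberTheory.EllipticCurves.CaiShuTian2014 Literature.NumberTheory.EllipticCurves.CoatesLiTianZhai2015
open Literature.NumberTheory.EllipticCurves.Tian2014 (IsQuadraticFieldOfSqrt fourTwoCard fourTwoCard_def)
open Literature.NumberTheory.EllipticCurves.LiLiuTian2024 (NoIdealClassOfOrderFour)
open Literature.NumberTheory.QuadraticFields.RedeiReichardt
open Literature.NumberTheory.EllipticCurves.LiLiuTian2024.RedeiFamilies (natCast_ne_zero_of_prime_ne)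
open Literature.Computability.Cryptography.Hallgren2005
open Literature.NumberTheory.ComplexMultiplication (CMTypeLattice.natCard_classGroup_QO_of_emod_four)

namespace Summit.BirchSwinnertonDyer.BirchSwinnertonDyer.Theorems.GoldfeldGoodTwists

/-! ## §1 Group theory: `#G[2] = 2^a`, `G² ∩ G[2] = 1` ⟹ `2^{a+1} ∤ #G` -/

/-- **`#G[2] = 2^a` and `#(G² ∩ G[2]) = 1` imply `2^{a+1} ∤ #G`** (finite abelian `G`): the squaring map has kernel `G[2]` and image `G²`,
so `#G = #G[2]·#G²`, and `G²` has odd order (its only element killed by `2` is `1`; Cauchy) — «`r₄ = 0` ⟹ `2^{t−1} ∥ h`».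
[cite: LiMa2008, Thm. 0.4 and the remark after it (p. 280)] [cite: Tian2014, proof of Lemma 5.1 (𝒜[4]/𝒜[2] ≃ 𝒜[2] ∩ 2𝒜)] -/
theorem not_dvd_natCard_of_fourTwoCard_eq_one {G : Type*} [CommGroup G] [Finite G] {a : ℕ}
    (h2 : Nat.card {c : G // c ^ 2 = 1} = 2 ^ a) (h4 : fourTwoCard G = 1) : ¬ 2 ^ (a + 1) ∣ Nat.card G := by
  set f : G →* G := powMonoidHom 2 with hf
  have hker : Nat.card f.ker = 2 ^ a := by
    rw [← h2]
    exact Nat.card_congr (Equiv.subtypeEquivRight fun c => by rw [MonoidHom.mem_ker, hf, powMonoidHom_apply])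
  rw [fourTwoCard_def] at h4
  obtain ⟨hsub, -⟩ := Nat.card_eq_one_iff_unique.mp h4
  have hodd : Odd (Nat.card f.range) := by
    refine odd_natCard_of_forall_sq_eq_one fun g hg => ?_
    obtain ⟨y, hy⟩ := g.2
    have hsq : IsSquare (g : G) := ⟨y, by rw [← hy, hf, powMonoidHom_apply, sq]⟩
    have hg1 : (g : G) ^ 2 = 1 := by rw [← Subgroup.coe_pow, hg, Subgroup.coe_one]
    have h := hsub.elim ⟨(g : G), hsq, hg1⟩ ⟨1, IsSquare.one, one_pow 2⟩
    exact OneMemClass.coe_eq_one.mp (congrArg Subtype.val h)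
  have hmul : Nat.card f.ker * Nat.card f.range = Nat.card G := by
    rw [← Subgroup.index_ker, Subgroup.card_mul_index]
  obtain ⟨m, hm⟩ := hodd
  rw [← hmul, hker, hm, pow_succ]
  intro hdvd
  have h2m : 2 ∣ 2 * m + 1 := Nat.dvd_of_mul_dvd_mul_left (pow_pos two_pos a) hdvd
  omega

/-! ## §2 The bridge `#Cl(𝒪_{d_K}) = #Cl(𝓞 K)` (Cox Thm. 7.7 (ii) on both carriers) -/
section Bridge
variable {K : Type} [Field K] [NumberField K]

/-- **`#Cl(𝒪_{d_K}) = #Cl(𝓞_K)`**: the class group of the tree's abstract maximal order `OrderCl.QO hK.negDiscr` (`D = d_K`) and Mathlib's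
`ClassGroup (𝓞 K)` have the same order — both are the form class number `h(d_K)` (Cox Thm. 7.7 (ii) on either carrier:
`CMTypeLattice.natCard_classGroup_QO_of_emod_four`, `Quadratic.card_reducedForms_eq_classNumber`). [cite: Cox2013, §7.B Thm. 7.7 (ii), pp. 137–138] -/
theorem natCard_classGroup_QO_negDiscr_eq (hK : IsImaginaryQuadratic K) :
    Nat.card (ClassGroup (OrderCl.QO hK.negDiscr)) = Nat.card (ClassGroup (𝓞 K)) := by
  classical
  have hD4 : hK.negDiscr.D % 4 = 0 ∨ hK.negDiscr.D % 4 = 1 := by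
    rw [hK.negDiscr_D]; exact QuadraticFields.Quadratic.discr_emod_four hK.1
  rw [CMTypeLattice.natCard_classGroup_QO_of_emod_four hK.negDiscr hD4, hK.negDiscr_D,
    QuadraticFields.Quadratic.card_reducedForms_eq_classNumber hK.1 hK.discr_neg, NumberField.classNumber,
    ← Nat.card_eq_fintype_card]

/-- `√d_K ∈ K`: `IsQuadraticFieldOfSqrt K d_K` in Tian's vocabulary. [folklore] [cite: Cox2013, §7.A (d_K and the integral basis)] -/
theorem isQuadraticFieldOfSqrt_discr (hK : IsImaginaryQuadratic K) : IsQuadraticFieldOfSqrt K (NumberField.discr K) := by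
  obtain ⟨-, -, δ, -, hδ⟩ := QuadraticFields.Quadratic.exists_sq_eq_discr hK.1
  have h := congrArg (algebraMap (𝓞 K) K) hδ
  rw [map_pow, map_intCast] at h
  exact ⟨hK.1, (δ : K), h⟩

/-- `K = ℚ(√(d_K/4))` when `4 ∣ d_K`: `IsQuadraticFieldOfSqrt K (d_K/4)`. [folklore] [cite: Cox2013, §7.A (d_K and the integral basis)] -/
theorem isQuadraticFieldOfSqrt_of_discr_eq_four_mul (hK : IsImaginaryQuadratic K) {d : ℤ} (hd : NumberField.discr K = 4 * d) :
    IsQuadraticFieldOfSqrt K d := by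
  obtain ⟨h2, x, hx⟩ := isQuadraticFieldOfSqrt_discr hK
  refine ⟨h2, x / 2, ?_⟩
  rw [div_pow, hx, hd]
  push_cast
  ring

/-- Gauss's count `#Cl_K[2] = 2^{t−1}` read off for `|d_K|` with a given set of prime factors. [cite: Cox2013, §3.A Prop. 3.11] -/
theorem natCard_sq_eq_one_classGroup_of_primeFactors (hK : IsImaginaryQuadratic K) {S : Finset ℕ}
    (hS : (NumberField.discr K).natAbs.primeFactors = S) :
    Nat.card {c : ClassGroup (𝓞 K) // c ^ 2 = 1} = 2 ^ (S.card - 1) := by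
  rw [QuadraticFields.Quadratic.card_sq_eq_one_classGroup hK, hS]

end Bridge

/-! ## §3 Rédei–Reichardt at `D = −qp` (`q ≡ 3 (mod 4)`, `p ≡ 1 (mod 4)`, `(p/q) = −1`) -/
section TwoPrimes
variable {q p : ℕ}

/-- **`RM(−qp) = [[1,1],[1,1]]`** on the tuple `(q, p)` when `(p/q) = −1`: `(D_p/q) = (p/q) = −1` and `(D_q/p) = (−q/p) = (q/p) = (p/q)
= −1` (`p ≡ 1 (mod 4)`, reciprocity); diagonal = row sums. [cite: LiMa2008, Def. 0.2 and Thm. 0.4 (pp. 279–280); evaluation ours]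
[cite: IrelandRosen1990, Ch. 5 §2 Thm. 2 (reciprocity)] -/
theorem redeiMatrix_negTwoPrimes (hq : q.Prime) (hp : p.Prime) (hq4 : q % 4 = 3) (hp4 : p % 4 = 1)
    (hpq : jacobiSym (p : ℤ) q = -1) : redeiMatrix (q * p) ![q, p] = !![1, 1; 1, 1] := by
  have dq : primeDisc (q * p) q = -(q : ℤ) := by rw [primeDisc_of_ne_two _ (by omega), if_neg (by omega)]
  have dp : primeDisc (q * p) p = p := by rw [primeDisc_of_ne_two _ (by omega), if_pos hp4]
  have hne : q ≠ p := by omega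
  have hqp : jacobiSym (-(q : ℤ)) p = -1 := by
    rw [jacobiSym.neg _ (Nat.odd_iff.mpr (by omega)), ZMod.χ₄_nat_one_mod_four hp4, one_mul,
      ← jacobiSym.quadratic_reciprocity_one_mod_four hp4 (Nat.odd_iff.mpr (by omega))]
    exact hpq
  have e01 : kroneckerBit (p : ℤ) q = 1 :=
    (kroneckerBit_eq_one_iff_jacobiSym hq (by omega) (natCast_ne_zero_of_prime_ne hq hp hne.symm)).mpr hpq
  have e10 : kroneckerBit (-(q : ℤ)) p = 1 := by
    refine (kroneckerBit_eq_one_iff_jacobiSym hp (by omega) ?_).mpr hqp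
    rw [Int.cast_neg, neg_ne_zero]
    exact natCast_ne_zero_of_prime_ne hp hq hne
  ext i j
  fin_cases i <;> fin_cases j <;>
    simp [redeiMatrix, Finset.sum_erase_eq_sub, Fin.sum_univ_two, dq, dp, e01, e10]

/-- Kernel count `2` (`rank RM = 1 = t − 1`, `r₄ = 0`) for `D = −qp`, `(p/q) = −1`. [cite: LiMa2008, Thm. 0.4 (p. 280)] -/
theorem card_ker_redeiMatrix_negTwoPrimes (hq : q.Prime) (hp : p.Prime) (hq4 : q % 4 = 3) (hp4 : p % 4 = 1)
    (hpq : jacobiSym (p : ℤ) q = -1) :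
    Fintype.card {v : Fin 2 → ZMod 2 // redeiMatrix (q * p) ![q, p] *ᵥ v = 0} = 2 := by
  have hM := redeiMatrix_negTwoPrimes hq hp hq4 hp4 hpq
  rw [Fintype.card_congr (Equiv.subtypeEquivRight
    (q := fun v : Fin 2 → ZMod 2 => (!![1, 1; 1, 1] : Matrix (Fin 2) (Fin 2) (ZMod 2)) *ᵥ v = 0)
    (fun v => by rw [hM]))]
  decide

/-- The side conditions of the Rédei door for the tuple `(q, p)`: primes, injective, `∏ = qp` with `qp ≡ 3 (mod 4)` (`D = −qp`).
[cite: LiMa2008, Lemma 0.1 (p. 279)] -/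
theorem redei_side_conditions_negTwoPrimes (hq : q.Prime) (hp : p.Prime) (hq4 : q % 4 = 3) (hp4 : p % 4 = 1) :
    (∀ i, ((![q, p] : Fin 2 → ℕ) i).Prime) ∧ Function.Injective (![q, p] : Fin 2 → ℕ) ∧
      (∏ i, (![q, p] : Fin 2 → ℕ) i) = if (q * p) % 4 = 1 then 2 * (q * p) else q * p := by
  have h4 : q * p % 4 = 3 := by rw [Nat.mul_mod, hq4, hp4]
  refine ⟨?_, ?_, ?_⟩
  · intro i; fin_cases i <;> assumption
  · intro i j h
    have : q ≠ p := by omega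
    fin_cases i <;> fin_cases j <;> simp_all
  · rw [if_neg (by omega), Fin.prod_univ_two]
    simp

/-- **`(p/q) = −1 ⟹ ℚ(√−qp)` has no ideal class of order `4`** (`q ≡ 3 (mod 4)`, `p ≡ 1 (mod 4)` primes), from the tree's PROVED
Rédei–Reichardt theorem — the hypothesis `hNo4` of THEOREM A⁗_β, discharged.
[cite: LiMa2008, Thm. 0.4 (p. 280); evaluation ours] [cite: LiLiuTian2024, Thm. 1.2 (hypothesis)] -/
theorem noIdealClassOfOrderFour_negTwoPrimes (hq : q.Prime) (hp : p.Prime) (hq4 : q % 4 = 3) (hp4 : p % 4 = 1)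
    (hpq : jacobiSym (p : ℤ) q = -1) : NoIdealClassOfOrderFour (-((q : ℤ) * p)) := by
  obtain ⟨hpr, hinj, hprod⟩ := redei_side_conditions_negTwoPrimes hq hp hq4 hp4
  have h := noIdealClassOfOrderFour_of_card_ker' hpr hinj hprod (card_ker_redeiMatrix_negTwoPrimes hq hp hq4 hp4 hpq)
  have e : (-((q * p : ℕ) : ℤ)) = -((q : ℤ) * p) := by push_cast; ring
  rwa [e] at h

/-- **`(p/q) = −1 ⟹ #(Cl² ∩ Cl[2]) = 1` for every quadratic `F ∋ √−qp`** (`r₄ = 0`). [cite: LiMa2008, Thm. 0.4 (p. 280); evaluation ours] -/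
theorem fourTwoCard_eq_one_negTwoPrimes (hq : q.Prime) (hp : p.Prime) (hq4 : q % 4 = 3) (hp4 : p % 4 = 1)
    (hpq : jacobiSym (p : ℤ) q = -1) (F : Type) [Field F] [NumberField F]
    (hF : IsQuadraticFieldOfSqrt F (-((q * p : ℕ) : ℤ))) : fourTwoCard (ClassGroup (𝓞 F)) = 1 := by
  obtain ⟨hpr, hinj, hprod⟩ := redei_side_conditions_negTwoPrimes hq hp hq4 hp4
  have h := fourTwoCard_eq_of_card_ker' hpr hinj hprod (e := 0)
    (by rw [card_ker_redeiMatrix_negTwoPrimes hq hp hq4 hp4 hpq]; rfl) F hF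
  rwa [pow_zero] at h

/-- **`(p/q) = −1 ⟹ 4 ∤ #Cl(𝒪_{−qp})`** on the tree's abstract-order carrier (`q ≡ 3 (mod 4)`, `p ≡ 1 (mod 4)` primes): `D = −qp` is
fundamental, `#Cl(𝒪_D) = h(D) = #Cl(𝓞_F)` for a quadratic field `F` of discriminant `D` (Cox Thm. 7.7 (ii), twice), `#Cl_F[2] = 2`
(Gauss, `t = 2`) and `r₄ = 0` (Rédei–Reichardt) — the hypothesis `h4e` of THEOREM A⁗_β, discharged.
[cite: LiMa2008, Thm. 0.4 (p. 280)] [cite: Cox2013, §3.A Prop. 3.11 and §7.B Thm. 7.7 (ii)] -/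
theorem not_four_dvd_natCard_classGroup_QO_negTwoPrimes (hq : q.Prime) (hp : p.Prime) (hq4 : q % 4 = 3) (hp4 : p % 4 = 1)
    (hpq : jacobiSym (p : ℤ) q = -1) (Δ : OrderCl.NegDiscr) (hΔ : Δ.D = -((q : ℤ) * p)) :
    ¬ 4 ∣ Nat.card (ClassGroup (OrderCl.QO Δ)) := by
  classical
  set n : ℕ := q * p with hn_def
  have hne : q ≠ p := by omega
  have hn4 : n % 4 = 3 := by rw [hn_def, Nat.mul_mod, hq4, hp4]
  have hnZ : (-((q : ℤ) * p)) = -(n : ℤ) := by rw [hn_def]; push_cast; ring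
  have hsqf : Squarefree n := (Nat.squarefree_mul ((Nat.coprime_primes hq hp).mpr hne)).mpr ⟨hq.squarefree, hp.squarefree⟩
  have hsqfZ : Squarefree (-(n : ℤ)) := (Int.squarefree_natCast.mpr hsqf).squarefree_of_dvd ⟨-1, by ring⟩
  -- a quadratic field `F` of discriminant `−qp`
  obtain ⟨F, _, _, h2, hdF⟩ := QuadraticFields.Quadratic.exists_numberField_discr_eq (D := -(n : ℤ))
    (Or.inl ⟨by omega, hsqfZ, by omega⟩)
  have hFq : IsImaginaryQuadratic F := isImaginaryQuadratic_iff_discr_neg.mpr ⟨h2, by rw [hdF]; have := hq.pos; omega⟩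
  -- `#Cl(𝒪_D) = h(D) = #Cl(𝓞_F)`
  have hD4 : Δ.D % 4 = 0 ∨ Δ.D % 4 = 1 := Or.inr (by rw [hΔ, hnZ]; omega)
  have hbridge : Nat.card (ClassGroup (OrderCl.QO Δ)) = Nat.card (ClassGroup (𝓞 F)) := by
    rw [CMTypeLattice.natCard_classGroup_QO_of_emod_four Δ hD4, hΔ, hnZ, ← hdF,
      QuadraticFields.Quadratic.card_reducedForms_eq_classNumber h2 hFq.discr_neg, NumberField.classNumber,
      ← Nat.card_eq_fintype_card]
  rw [hbridge]
  -- Gauss: `#Cl_F[2] = 2`; Rédei: `r₄ = 0`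
  have h2tor : Nat.card {c : ClassGroup (𝓞 F) // c ^ 2 = 1} = 2 ^ 1 := by
    rw [natCard_sq_eq_one_classGroup_of_primeFactors hFq (S := {q, p}) ?_]
    · rw [Finset.card_insert_of_notMem (by simp [hne]), Finset.card_singleton]
    · rw [hdF, Int.natAbs_neg, Int.natAbs_natCast, hn_def, Nat.primeFactors_mul hq.ne_zero hp.ne_zero, hq.primeFactors,
        hp.primeFactors]
      rfl
  have h := not_dvd_natCard_of_fourTwoCard_eq_one h2tor
    (fourTwoCard_eq_one_negTwoPrimes hq hp hq4 hp4 hpq F (hdF ▸ isQuadraticFieldOfSqrt_discr hFq))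
  rwa [show (2 : ℕ) ^ (1 + 1) = 4 by norm_num] at h

end TwoPrimes

/-! ## §4 Rédei–Reichardt at `d_K = −8qp` -/
section EightTwoPrimes
variable {K : Type} [Field K] [NumberField K]

/-- **`8 ∤ #Cl(𝒪_{d_K})` for `d_K = −8qp`** with primes `q ≡ 3 (mod 4)`, `p ≡ 5 (mod 8)` and `(p/q) = −1` or `q ≡ 3 (mod 8)`:
`#Cl(𝒪_{d_K}) = #Cl(𝓞_K)` (§2), `#Cl_K[2] = 4` (Gauss, `t = 3`) and `#(Cl_K² ∩ Cl_K[2]) = 1` (the tree's PROVED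
`fourTwoCard_classGroup_eq_one_of_sqrt_neg_two_mul_primes`, `√−2qp = √d_K/2 ∈ K`) — the hypothesis `h8` of THEOREM A⁗_β,
discharged. [cite: Stevenhagen1995RedeiMatrices, §2 Thm. 1 (l = 2)] [cite: LiMa2008, Thm. 0.4] [cite: Cox2013, §3.A Prop. 3.11, §7.B Thm. 7.7 (ii)] -/
theorem not_eight_dvd_natCard_classGroup_QO_negEightTwoPrimes (hK : IsImaginaryQuadratic K) {q p : ℕ} (hq : q.Prime)
    (hp : p.Prime) (hq4 : q % 4 = 3) (hp8 : p % 8 = 5) (hpq : jacobiSym (p : ℤ) q = -1 ∨ q % 8 = 3)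
    (hdK : NumberField.discr K = -(8 * (q : ℤ) * p)) : ¬ 8 ∣ Nat.card (ClassGroup (OrderCl.QO hK.negDiscr)) := by
  classical
  have hne : q ≠ p := by omega
  rw [natCard_classGroup_QO_negDiscr_eq hK]
  have hK' : IsQuadraticFieldOfSqrt K (-((2 * (p * q) : ℕ) : ℤ)) :=
    isQuadraticFieldOfSqrt_of_discr_eq_four_mul hK (by rw [hdK]; push_cast; ring)
  have h42 := fourTwoCard_classGroup_eq_one_of_sqrt_neg_two_mul_primes hp hq hp8 hq4 hpq hK'
  have h2tor : Nat.card {c : ClassGroup (𝓞 K) // c ^ 2 = 1} = 2 ^ 2 := by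
    rw [natCard_sq_eq_one_classGroup_of_primeFactors hK (S := {2, q, p}) ?_]
    · rw [Finset.card_insert_of_notMem (by simp; omega), Finset.card_insert_of_notMem (by simp [hne]), Finset.card_singleton]
    · rw [hdK, show (-(8 * (q : ℤ) * p)) = -((2 ^ 3 * (q * p) : ℕ) : ℤ) by push_cast; ring, Int.natAbs_neg, Int.natAbs_natCast,
        Nat.primeFactors_mul (by positivity) (Nat.mul_ne_zero hq.ne_zero hp.ne_zero),
        Nat.primeFactors_prime_pow (by norm_num) Nat.prime_two, Nat.primeFactors_mul hq.ne_zero hp.ne_zero, hq.primeFactors,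
        hp.primeFactors]
      rfl
  have h := not_dvd_natCard_of_fourTwoCard_eq_one h2tor h42
  rwa [show (2 : ℕ) ^ (2 + 1) = 8 by norm_num] at h

end EightTwoPrimes

/-! ## §5 THEOREM A⁗_β′: the class-group hypotheses discharged (only `(p/q) = −1` remains), and consumers -/
section Consumers

open scoped Classical -- the statements below live in A2b's point-group world (`DecidableEq K` for `X₀(49)(K)`); section-scoped

variable (hCST : thm11_ringClassChar)
  (hGZ : ∀ (N : ℕ) [NeZero N] (W : WeierstrassCurve ℚ) (K : Type) [Field K] [NumberField K], gross_zagier N W K)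
  (h12 : thm12_fullBSD_twist) (h44 : thm44_ord_two_LAlg) (h13 : thm13_ord_two_LAlg) (h14 : thm14_rankOne_twist)
  (hS31 : bsdTriple_of_rank_le_one_of_conductor_lt) (hnew : exists_isNewformOf) (hM : OptimalCurveManinCertificate cm7)
  (hBT : burungaleTian_analyticRank_eq_zero_of_selmerCorank_eq_zero_of_hasCM) (hBF : bsdTriple_of_hasCM_of_L_one_ne_zero)
  (hGZK : rank_eq_analyticRank_of_analyticRank_le_one) (hEta : x049_heegner_norm_x_sub_two_not_mem)
include hCST hGZ h12 h44 h13 h14 hS31 hnew hM hBT hBF hGZK hEta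

/-- **THEOREM A⁗_β′ FROM PRINT, CLASS-GROUP CONDITIONS DISCHARGED.** A2b's `heegnerNonTorsion_negEightTwoPrimes_beta_of_print` (THIRTEEN
print binders; cells `q > 3` prime, `q ≡ 3 (mod 4)`, `(q/7) = −1`; `p ≡ 5 (mod 8)` prime, `(−7/p) = +1`, `−7` a fourth power mod `p`) with
`hNo4 h4e h8` REPLACED by their Rédei value `jacobiSym p q = −1` (§3–§4; «bridge absent: none»): **for every imaginary quadratic `K` with
`d_K = −8qp`, every level-`49` Heegner point of `X₀(49)` over `K` has infinite order.** Not BSD for anyone.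
[cite: Gross1984, §§4–5] [cite: GrossLMS1991, Prop. 5.3] [cite: LiMa2008, Thm. 0.4] [cite: CoatesLiTianZhai2015, Thm. 1.2–1.4 and 4.4] -/
theorem heegnerNonTorsion_negEightTwoPrimes_beta_of_print'
    {q p : ℕ} (hq : q.Prime) (h3 : 3 < q) (hq4 : q % 4 = 3) (hq7 : jacobiSym q 7 = -1)
    [Fact p.Prime] (hp8 : p % 8 = 5) (hp7 : legendreSym p (-7) = 1) (hβ : ∃ x : ZMod p, x ^ 4 = -7) (hpq : jacobiSym (p : ℤ) q = -1)
    (K : Type) [Field K] [NumberField K] (hK : IsImaginaryQuadratic K) (hdK : NumberField.discr K = -(8 * (q : ℤ) * p))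
    (P : (cm7.baseChange K).toAffine.Point) (hP : IsHeegnerPoint 49 cm7 K P) : ¬ IsOfFinAddOrder P :=
  have hp : p.Prime := Fact.out
  heegnerNonTorsion_negEightTwoPrimes_beta_of_print hCST hGZ h12 h44 h13 h14 hS31 hnew hM hBT hBF hGZK hEta hq h3 hq4 hq7 hp8 hp7 hβ
    (noIdealClassOfOrderFour_negTwoPrimes hq hp hq4 (by omega) hpq)
    (not_four_dvd_natCard_classGroup_QO_negTwoPrimes hq hp hq4 (by omega) hpq) K hK hdK
    (not_eight_dvd_natCard_classGroup_QO_negEightTwoPrimes hK hq hp hq4 hp8 (Or.inl hpq) hdK) P hP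

/-- **`ord_{s=1} L(X₀(49)/K, s) = 1`** for every imaginary quadratic `K` with `d_K = −8qp` on the cells of A⁗_β with `(p/q) = −1`, from print —
A2b's consumer with the class-group hypotheses discharged. [cite: GrossZagier1986, Thm. I.(6.3)] [cite: Gross1984, §§4–5] [cite: LiMa2008, Thm. 0.4] -/
theorem analyticRankEK_cm7_eq_one_negEightTwoPrimes_beta_of_print'
    {q p : ℕ} (hq : q.Prime) (h3 : 3 < q) (hq4 : q % 4 = 3) (hq7 : jacobiSym q 7 = -1)
    [Fact p.Prime] (hp8 : p % 8 = 5) (hp7 : legendreSym p (-7) = 1) (hβ : ∃ x : ZMod p, x ^ 4 = -7) (hpq : jacobiSym (p : ℤ) q = -1)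
    (K : Type) [Field K] [NumberField K] (hK : IsImaginaryQuadratic K) (hdK : NumberField.discr K = -(8 * (q : ℤ) * p)) :
    analyticRankEK cm7 K = 1 :=
  have hp : p.Prime := Fact.out
  analyticRankEK_cm7_eq_one_negEightTwoPrimes_beta_of_print hCST hGZ h12 h44 h13 h14 hS31 hnew hM hBT hBF hGZK hEta hq h3 hq4 hq7
    hp8 hp7 hβ (noIdealClassOfOrderFour_negTwoPrimes hq hp hq4 (by omega) hpq)
    (not_four_dvd_natCard_classGroup_QO_negTwoPrimes hq hp hq4 (by omega) hpq) K hK hdK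
    (not_eight_dvd_natCard_classGroup_QO_negEightTwoPrimes hK hq hp hq4 hp8 (Or.inl hpq) hdK)

/-- **`r_an(W) = 1`, `rank W(ℚ) = 1`, `Ш(W)` finite for every `W ≅ 49a1^{(−2qp)}`** on the cells of A⁗_β with `(p/q) = −1`, from print — A2b's
consumer with ALL class-group hypotheses discharged by Rédei–Reichardt. A WITNESS FAMILY of twist-density zero; not a closer of any item; BSD
is not proved. [cite: CoatesLiTianZhai2015, Thm. 1.2 and Thm. 1.4] [cite: GrossZagier1986, Thm. I.(6.3)] [cite: LiMa2008, Thm. 0.4] -/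
theorem analyticRank_eq_one_twoPrimesTwist_beta_of_print'
    {q p : ℕ} (hq : q.Prime) (h3 : 3 < q) (hq4 : q % 4 = 3) (hq7 : jacobiSym q 7 = -1)
    [Fact p.Prime] (hp8 : p % 8 = 5) (hp7 : legendreSym p (-7) = 1) (hβ : ∃ x : ZMod p, x ^ 4 = -7) (hpq : jacobiSym (p : ℤ) q = -1)
    (W : WeierstrassCurve ℚ) [W.IsElliptic] (C : VariableChange ℚ) (hC : C • W = cm7.quadraticTwist (-(2 * (q : ℚ) * p))) :
    W.analyticRank = 1 ∧ W.mordellWeilRank = 1 ∧ Finite W.sha :=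
  have hp : p.Prime := Fact.out
  analyticRank_eq_one_twoPrimesTwist_beta_of_print hCST hGZ h12 h44 h13 h14 hS31 hnew hM hBT hBF hGZK hEta hq h3 hq4 hq7 hp8 hp7 hβ
    (noIdealClassOfOrderFour_negTwoPrimes hq hp hq4 (by omega) hpq)
    (not_four_dvd_natCard_classGroup_QO_negTwoPrimes hq hp hq4 (by omega) hpq)
    (fun K _ _ hK hdK ↦ not_eight_dvd_natCard_classGroup_QO_negEightTwoPrimes hK hq hp hq4 hp8 (Or.inl hpq) hdK) W C hC

end Consumers

end Summit.BirchSwinnertonDyer.BirchSwinnertonDyer.Theorems.GoldfeldGoodTwists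

end
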